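import Mathlib.Analysis.SpecialFunctions.Log.PosLog
import Mathlib.Analysis.Complex.Basic
import Mathlib.NumberTheory.NumberField.InfinitePlace.Basic
import Mathlib.Topology.MetricSpace.ProperSpace
import HarnessLib

/-!
# The ramification form `N` of the cover `D_e : r^e = x(1−x)` of `ℙ¹`: archimedean lower bound
# under separation from its zeros ([GenEll] Thm. 2.1 (ii) ⇒ (i), archimedean bookkeeping)

S. Mochizuki, *Arithmetic elliptic curves in general position*, Math. J. Okayama Univ. **52** (2010)
[cite: MochizukiGenEll2010, Thm 2.1 p.12]: in the proof of Thm. 2.1, (ii) ⇒ (i) (kurims pp. 12–13) the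
height of a point of the auxiliary hyperbolic curve is compared with conductors through a noncritical
Belyi map; the archimedean contribution is controlled by "the compactness of the set of rational points
of `X` over any finite extension of `ℚ_v` for `v ∈ V`" (p. 12).  In the number-field-only rendering of
that proof used by the abc-iut cell for `(X, D) = (ℙ¹, [0]+[1]+[∞])` (work-package map
GENELLTWO-P1ROUTE §3 (d), package W5b; route item `Summit.ABC.ABC.Theses.IUTThetaPilot.GenEllTwo`) the
auxiliary curve is the cyclic cover `D_e : r^e = x(1 − x)` (`e = 2k+1 ≥ 5` odd), `s := 1 − 2x`
(so `s² = 1 − 4r^e`), and the ramification divisor of the function `t = 1/r + r^{(e+1)/2}/s` on the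
affine part is cut out by

  `N := r²s³ · dt/dr = −s³ + ((e+1)/2)·r^{(e+3)/2} − 2·r^{(3e+3)/2} = −(1−2x)³ + (k+1)·r^{k+2} − 2·r^{3k+3}`.

The archimedean term of the height of `N(P)` is `Σ_σ log⁺ ‖σ(N(P))‖⁻¹` over the complex embeddings
`σ`; it is bounded as soon as every conjugate `(σ x, σ r)` stays `ρ`-far from the zeros of `N` on
`D_e(ℂ)` (these zeros are the affine ramification points `R_t ⊆ E_φ`, so `ρ`-separation from `E_φ`,
the hypothesis of the properness package W7, suffices — `exists_pos_le_norm_N_of_separated_of_subset`).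
This file proves exactly that, from scratch over Mathlib:

* `DeArch.N`, `DeArch.curve` — the polynomial `N` (over any commutative ring; `map_N`) and the affine
  point set of `D_e` in the coordinates `(x, r)`; `DeArch.sq_sub_eq` (`(1−2x)² = 1 − 4r^e` on `D_e`);
* GROWTH (`norm_snd_lt_six`, `norm_fst_le`): on `D_e(ℂ)`, `‖N(P)‖ ≤ 1 ⇒ ‖r‖ < 6 ∧ ‖x‖ ≤ 6^e`
  (explicitly: for `‖r‖ ≥ 6`, `‖s‖⁶ = ‖1 − 4r^e‖³ ≤ 125‖r‖^{6k+3} < ‖r‖^{6k+6} ≤ (‖A‖ − 1)²` with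
  `A := (k+1)r^{k+2} − 2r^{3k+3}`, whence `‖N‖ ≥ ‖A‖ − ‖s‖³ > 1`);
* COMPACTNESS (`isCompact_sublevel`): `{P ∈ D_e(ℂ) | ‖N(P)‖ ≤ 1}` is compact;
* LOWER BOUND (`exists_pos_le_norm_N_of_separated`): `∀ ρ > 0 ∃ c > 0`, every `P ∈ D_e(ℂ)` with
  `dist P Q ≥ ρ` for all zeros `Q` of `N` on `D_e(ℂ)` has `‖N(P)‖ ≥ c` (minimum of `‖N‖` on the compact
  `ρ`-separated sublevel piece); distances on `ℂ × ℂ` are the sup-distances `max (‖x−x′‖) (‖r−r′‖)`;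
* NUMBER-FIELD FORM (`exists_sum_posLog_le`): `∀ ρ > 0 ∃ C ≥ 0`, for every number field `K` and
  `x r : K` on `D_e` all of whose conjugates are `ρ`-separated, `Σ_{σ : K →+* ℂ} log⁺ ‖σ(N x r)‖⁻¹ ≤ [K:ℚ]·C`
  (and the `InfinitePlace` form `posLog_infinitePlace_le`).

Everything is proved; two definitions (`N`, `curve`), no named facts.  Classical and undisputed; nothing
here refers to the disputed parts of the abc-iut corpus.  Deliberately NOT here: the identification of
the zeros of `N` with the ramification points of `t` and `R_t ⊆ E_φ` (package W9), the good-prime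
multiplicity inequality (W5a), heights on `D_e` (W4a), the `2`-adic side (no lower bound is needed there).
-/

noncomputable section

open Real

namespace Literature.NumberTheory.DiophantineGeometry.GenEll

namespace DeArch

/-! ### The ramification form and the curve -/

/-- The ramification form of `t = 1/r + r^{k+1}/s` on `D_e : r^{2k+1} = x(1−x)`, `s = 1 − 2x`:
`N = r²s³·dt/dr = −(1−2x)³ + (k+1)·r^{k+2} − 2·r^{3k+3}` (GENELLTWO-P1ROUTE §3 (d); `e = 2k+1`).
[cite: MochizukiGenEll2010, Thm 2.1 p.12] -/
def N {R : Type*} [CommRing R] (k : ℕ) (x r : R) : R :=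
  -(1 - 2 * x) ^ 3 + ((k : R) + 1) * r ^ (k + 2) - 2 * r ^ (3 * k + 3)

/-- The affine point set of the cover `D_e : r^e = x(1 − x)` of `ℙ¹ ∖ {0,1,∞}`, `e = 2k+1`, in the
coordinates `(x, r)`. [cite: MochizukiGenEll2010, Thm 2.1 p.12] -/
def curve (R : Type*) [CommRing R] (k : ℕ) : Set (R × R) :=
  {P | P.2 ^ (2 * k + 1) = P.1 * (1 - P.1)}

variable {R S : Type*} [CommRing R] [CommRing S]

/-- Membership in `D_e`: `r^{2k+1} = x(1−x)`. [cite: MochizukiGenEll2010, Thm 2.1 p.12] -/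
theorem mem_curve_iff {k : ℕ} {P : R × R} : P ∈ curve R k ↔ P.2 ^ (2 * k + 1) = P.1 * (1 - P.1) :=
  Iff.rfl

/-- `N` commutes with ring homomorphisms (so `σ(N(P)) = N(σ P)` for every embedding `σ`).
[cite: MochizukiGenEll2010, Thm 2.1 p.12] -/
theorem map_N (f : R →+* S) (k : ℕ) (x r : R) : f (N k x r) = N k (f x) (f r) := by
  simp [N, map_sub, map_add, map_neg, map_mul, map_pow, map_natCast, map_ofNat]

/-- Ring homomorphisms map points of `D_e` to points of `D_e`. [cite: MochizukiGenEll2010, Thm 2.1 p.12] -/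
theorem map_mem_curve (f : R →+* S) {k : ℕ} {P : R × R} (hP : P ∈ curve R k) :
    (f P.1, f P.2) ∈ curve S k := by
  rw [mem_curve_iff] at hP ⊢
  simpa [map_pow, map_mul, map_sub, map_one] using congrArg f hP

/-- On `D_e`: `s² = 1 − 4r^e` for `s = 1 − 2x`. [cite: MochizukiGenEll2010, Thm 2.1 p.12] -/
theorem sq_sub_eq {k : ℕ} {P : R × R} (hP : P ∈ curve R k) :
    (1 - 2 * P.1) ^ 2 = 1 - 4 * P.2 ^ (2 * k + 1) := by
  rw [mem_curve_iff] at hP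
  rw [hP]; ring

/-- `N = A − s³` with `A := (k+1)r^{k+2} − 2r^{3k+3}`, `s = 1 − 2x`. [cite: MochizukiGenEll2010, Thm 2.1 p.12] -/
theorem N_eq (k : ℕ) (x r : R) :
    N k x r = (((k : R) + 1) * r ^ (k + 2) - 2 * r ^ (3 * k + 3)) - (1 - 2 * x) ^ 3 := by
  unfold N; ring

/-! ### Growth of `N` along `D_e(ℂ)` -/

section Complex

variable {k : ℕ}

/-- Auxiliary real inequality: for `R ≥ 2`, `(k+1)·R^{k+2} + 1 ≤ R^{3k+3}`.
[cite: MochizukiGenEll2010, Thm 2.1 p.12] -/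
theorem pow_aux {R : ℝ} (hR : 2 ≤ R) (k : ℕ) :
    ((k : ℝ) + 1) * R ^ (k + 2) + 1 ≤ R ^ (3 * k + 3) := by
  have hR1 : (1 : ℝ) ≤ R := by linarith
  have h1 : (1 : ℝ) ≤ R ^ (k + 2) := one_le_pow₀ hR1
  have hnat : 2 * k + 2 ≤ 2 ^ (2 * k + 1) := by
    have := @Nat.lt_two_pow_self (2 * k + 1)
    omega
  have h2 : (2 : ℝ) * ((k : ℝ) + 1) ≤ R ^ (2 * k + 1) := by
    have h2a : ((2 * k + 2 : ℕ) : ℝ) ≤ ((2 ^ (2 * k + 1) : ℕ) : ℝ) := by exact_mod_cast hnat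
    have h2b : ((2 ^ (2 * k + 1) : ℕ) : ℝ) ≤ R ^ (2 * k + 1) := by
      push_cast
      exact pow_le_pow_left₀ (by norm_num) hR _
    have h2c : (2 : ℝ) * ((k : ℝ) + 1) = ((2 * k + 2 : ℕ) : ℝ) := by push_cast; ring
    linarith
  have hk : (0 : ℝ) ≤ (k : ℝ) + 1 := by positivity
  have h3 : (1 : ℝ) ≤ ((k : ℝ) + 1) * R ^ (k + 2) := by nlinarith
  calc ((k : ℝ) + 1) * R ^ (k + 2) + 1
      ≤ (2 * ((k : ℝ) + 1)) * R ^ (k + 2) := by linarith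
    _ ≤ R ^ (2 * k + 1) * R ^ (k + 2) := by gcongr
    _ = R ^ (3 * k + 3) := by ring

/-- GROWTH: on `D_e(ℂ)`, `‖N(P)‖ ≤ 1` forces `‖r‖ < 6`. [cite: MochizukiGenEll2010, Thm 2.1 p.12] -/
theorem norm_snd_lt_six {P : ℂ × ℂ} (hP : P ∈ curve ℂ k) (hN : ‖N k P.1 P.2‖ ≤ 1) : ‖P.2‖ < 6 := by
  by_contra h6
  rw [not_lt] at h6
  set x := P.1
  set r := P.2
  set Rr : ℝ := ‖r‖ with hRr
  set s : ℂ := 1 - 2 * x with hs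
  set A : ℂ := ((k : ℂ) + 1) * r ^ (k + 2) - 2 * r ^ (3 * k + 3) with hA
  have hR2 : (2 : ℝ) ≤ Rr := by linarith
  have hR1 : (1 : ℝ) ≤ Rr := by linarith
  have hR0 : (0 : ℝ) ≤ Rr := by linarith
  -- (a) lower bound for ‖A‖
  have hA1 : ‖(2 : ℂ) * r ^ (3 * k + 3)‖ = 2 * Rr ^ (3 * k + 3) := by
    rw [norm_mul, norm_pow, Complex.norm_ofNat]
  have hA2 : ‖((k : ℂ) + 1) * r ^ (k + 2)‖ = ((k : ℝ) + 1) * Rr ^ (k + 2) := by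
    rw [norm_mul, norm_pow]
    congr 1
    have : ((k : ℂ) + 1) = ((k + 1 : ℕ) : ℂ) := by push_cast; ring
    rw [this, Complex.norm_natCast, Nat.cast_add, Nat.cast_one]
  have hAlow : 2 * Rr ^ (3 * k + 3) - ((k : ℝ) + 1) * Rr ^ (k + 2) ≤ ‖A‖ := by
    have := norm_sub_norm_le ((2 : ℂ) * r ^ (3 * k + 3)) (((k : ℂ) + 1) * r ^ (k + 2))
    rw [hA1, hA2] at this
    have hAA : ‖A‖ = ‖(2 : ℂ) * r ^ (3 * k + 3) - ((k : ℂ) + 1) * r ^ (k + 2)‖ := by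
      rw [show A = -((2 : ℂ) * r ^ (3 * k + 3) - ((k : ℂ) + 1) * r ^ (k + 2)) by rw [hA]; ring,
        norm_neg]
    linarith
  have haux := pow_aux hR2 k
  have hAm1 : Rr ^ (3 * k + 3) ≤ ‖A‖ - 1 := by linarith
  have hAm1' : (0 : ℝ) ≤ ‖A‖ - 1 := (pow_nonneg hR0 _).trans hAm1
  -- (c) upper bound for ‖s‖^6
  have hs2 : s ^ 2 = 1 - 4 * r ^ (2 * k + 1) := sq_sub_eq hP
  have hs6 : ‖s‖ ^ 6 ≤ 125 * Rr ^ (6 * k + 3) := by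
    have h1 : ‖s‖ ^ 6 = ‖1 - 4 * r ^ (2 * k + 1)‖ ^ 3 := by
      rw [← hs2, norm_pow]; ring
    have h2 : ‖(1 : ℂ) - 4 * r ^ (2 * k + 1)‖ ≤ 5 * Rr ^ (2 * k + 1) := by
      have h21 : ‖(1 : ℂ) - 4 * r ^ (2 * k + 1)‖ ≤ 1 + 4 * Rr ^ (2 * k + 1) := by
        refine (norm_sub_le _ _).trans ?_
        rw [norm_one, norm_mul, norm_pow, Complex.norm_ofNat]
      have h22 : (1 : ℝ) ≤ Rr ^ (2 * k + 1) := one_le_pow₀ hR1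
      linarith
    have h3 : ‖(1 : ℂ) - 4 * r ^ (2 * k + 1)‖ ^ 3 ≤ (5 * Rr ^ (2 * k + 1)) ^ 3 :=
      pow_le_pow_left₀ (norm_nonneg _) h2 3
    have h4 : (5 * Rr ^ (2 * k + 1)) ^ 3 = 125 * Rr ^ (6 * k + 3) := by ring
    rw [h1]; linarith
  -- (d) 125 R^{6k+3} < R^{6k+6} = (R^{3k+3})² ≤ (‖A‖ - 1)²
  have hlt : 125 * Rr ^ (6 * k + 3) < (‖A‖ - 1) ^ 2 := by
    have h1 : 125 * Rr ^ (6 * k + 3) < Rr ^ (6 * k + 6) := by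
      have h3 : (216 : ℝ) ≤ Rr ^ 3 := by
        have := pow_le_pow_left₀ (by norm_num : (0 : ℝ) ≤ 6) h6 3
        norm_num at this
        exact this
      have hp : (0 : ℝ) < Rr ^ (6 * k + 3) := pow_pos (by linarith) _
      have : Rr ^ (6 * k + 6) = Rr ^ 3 * Rr ^ (6 * k + 3) := by ring
      rw [this]
      nlinarith [mul_le_mul_of_nonneg_right h3 hp.le]
    have h2 : Rr ^ (6 * k + 6) = (Rr ^ (3 * k + 3)) ^ 2 := by ring
    have h3 : (Rr ^ (3 * k + 3)) ^ 2 ≤ (‖A‖ - 1) ^ 2 := pow_le_pow_left₀ (pow_nonneg hR0 _) hAm1 2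
    linarith
  -- (e) hence ‖s‖³ < ‖A‖ - 1
  have hs3 : ‖s‖ ^ 3 < ‖A‖ - 1 := by
    have : (‖s‖ ^ 3) ^ 2 < (‖A‖ - 1) ^ 2 := by
      have h : (‖s‖ ^ 3) ^ 2 = ‖s‖ ^ 6 := by ring
      rw [h]; linarith
    exact lt_of_pow_lt_pow_left₀ 2 hAm1' this
  -- (f) ‖N‖ ≥ ‖A‖ - ‖s‖³ > 1
  have hNeq : N k x r = A - s ^ 3 := by rw [N_eq]
  have hNlow : ‖A‖ - ‖s‖ ^ 3 ≤ ‖N k x r‖ := by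
    rw [hNeq, ← norm_pow]
    exact norm_sub_norm_le _ _
  linarith

/-- GROWTH: on `D_e(ℂ)`, `‖N(P)‖ ≤ 1` forces `‖x‖ ≤ 6^e`. [cite: MochizukiGenEll2010, Thm 2.1 p.12] -/
theorem norm_fst_le {P : ℂ × ℂ} (hP : P ∈ curve ℂ k) (hN : ‖N k P.1 P.2‖ ≤ 1) :
    ‖P.1‖ ≤ 6 ^ (2 * k + 1) := by
  have hr := norm_snd_lt_six hP hN
  have heq : ‖P.1‖ * ‖1 - P.1‖ = ‖P.2‖ ^ (2 * k + 1) := by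
    rw [← norm_mul, ← norm_pow, (mem_curve_iff.mp hP)]
  have hpow : ‖P.2‖ ^ (2 * k + 1) < 6 ^ (2 * k + 1) :=
    pow_lt_pow_left₀ hr (norm_nonneg _) (by omega)
  have h6 : (6 : ℝ) ≤ 6 ^ (2 * k + 1) := by
    calc (6 : ℝ) = 6 ^ 1 := by norm_num
      _ ≤ 6 ^ (2 * k + 1) := pow_le_pow_right₀ (by norm_num) (by omega)
  by_cases hx : ‖P.1‖ ≤ 2
  · linarith
  · rw [not_le] at hx
    have h1 : 1 ≤ ‖1 - P.1‖ := by
      have := norm_sub_norm_le P.1 1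
      rw [norm_one] at this
      have h' : ‖P.1 - 1‖ = ‖1 - P.1‖ := norm_sub_rev _ _
      linarith
    have : ‖P.1‖ ≤ ‖P.1‖ * ‖1 - P.1‖ := by
      nlinarith [norm_nonneg P.1]
    linarith

/-! ### Compactness of the sublevel set and the lower bound -/

/-- `D_e(ℂ)` is closed in `ℂ × ℂ`. [cite: MochizukiGenEll2010, Thm 2.1 p.12] -/
theorem isClosed_curve (k : ℕ) : IsClosed (curve ℂ k) := by
  have : curve ℂ k = {P : ℂ × ℂ | P.2 ^ (2 * k + 1) = P.1 * (1 - P.1)} := rfl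
  rw [this]
  exact isClosed_eq (by fun_prop) (by fun_prop)

/-- `N` is continuous on `ℂ × ℂ`. [cite: MochizukiGenEll2010, Thm 2.1 p.12] -/
theorem continuous_N (k : ℕ) : Continuous fun P : ℂ × ℂ => N k P.1 P.2 := by
  unfold N; fun_prop

/-- COMPACTNESS: the sublevel set `{P ∈ D_e(ℂ) | ‖N(P)‖ ≤ 1}` is compact ("the compactness of the set of
rational points … over any finite extension of `ℚ_v`", here `v = ∞`). [cite: MochizukiGenEll2010, Thm 2.1 p.12] -/
theorem isCompact_sublevel (k : ℕ) : IsCompact {P : ℂ × ℂ | P ∈ curve ℂ k ∧ ‖N k P.1 P.2‖ ≤ 1} := by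
  refine Metric.isCompact_of_isClosed_isBounded ?_ ?_
  · exact (isClosed_curve k).inter (isClosed_le (continuous_norm.comp (continuous_N k)) continuous_const)
  · refine (Metric.isBounded_closedBall (x := (0 : ℂ × ℂ)) (r := 6 ^ (2 * k + 1))).subset ?_
    intro P hP
    rw [Metric.mem_closedBall, dist_zero_right, Prod.norm_def]
    refine max_le (norm_fst_le hP.1 hP.2) ((norm_snd_lt_six hP.1 hP.2).le.trans ?_)
    calc (6 : ℝ) = 6 ^ 1 := by norm_num
      _ ≤ 6 ^ (2 * k + 1) := pow_le_pow_right₀ (by norm_num) (by omega)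

/-- LOWER BOUND UNDER SEPARATION: for every `ρ > 0` there is `c > 0` such that every point `P` of
`D_e(ℂ)` lying at sup-distance `≥ ρ` from all zeros of `N` on `D_e(ℂ)` satisfies `‖N(P)‖ ≥ c` — the
archimedean term of the height of `N(P)` is bounded under `ρ`-separation of the conjugates from the
ramification points. [cite: MochizukiGenEll2010, Thm 2.1 p.12] -/
theorem exists_pos_le_norm_N_of_separated (k : ℕ) {ρ : ℝ} (hρ : 0 < ρ) :
    ∃ c : ℝ, 0 < c ∧ ∀ P ∈ curve ℂ k,
      (∀ Q ∈ curve ℂ k, N k Q.1 Q.2 = 0 → ρ ≤ dist P Q) → c ≤ ‖N k P.1 P.2‖ := by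
  classical
  have hclosed : IsClosed {P : ℂ × ℂ | ∀ Q ∈ curve ℂ k, N k Q.1 Q.2 = 0 → ρ ≤ dist P Q} := by
    rw [Set.setOf_forall]
    refine isClosed_iInter fun Q => ?_
    by_cases hQ : Q ∈ curve ℂ k ∧ N k Q.1 Q.2 = 0
    · have hQ' : {P : ℂ × ℂ | Q ∈ curve ℂ k → N k Q.1 Q.2 = 0 → ρ ≤ dist P Q} =
          {P | ρ ≤ dist P Q} := by
        ext P
        simp only [Set.mem_setOf_eq]
        exact ⟨fun h => h hQ.1 hQ.2, fun h _ _ => h⟩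
      rw [hQ']
      exact isClosed_le continuous_const (continuous_id.dist continuous_const)
    · have hQ' : {P : ℂ × ℂ | Q ∈ curve ℂ k → N k Q.1 Q.2 = 0 → ρ ≤ dist P Q} = Set.univ := by
        ext P
        simp only [Set.mem_setOf_eq, Set.mem_univ, iff_true]
        exact fun h1 h2 => absurd ⟨h1, h2⟩ hQ
      rw [hQ']
      exact isClosed_univ
  set T : Set (ℂ × ℂ) := {P : ℂ × ℂ | P ∈ curve ℂ k ∧ ‖N k P.1 P.2‖ ≤ 1} ∩
    {P | ∀ Q ∈ curve ℂ k, N k Q.1 Q.2 = 0 → ρ ≤ dist P Q} with hT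
  have hTc : IsCompact T := (isCompact_sublevel k).inter_right hclosed
  by_cases hne : T.Nonempty
  · obtain ⟨P₀, hP₀T, hmin⟩ :=
      hTc.exists_isMinOn hne (continuous_norm.comp (continuous_N k)).continuousOn
    have hpos : 0 < ‖N k P₀.1 P₀.2‖ := by
      rw [norm_pos_iff]
      intro h0
      have := hP₀T.2 P₀ hP₀T.1.1 h0
      rw [dist_self] at this
      linarith
    refine ⟨min 1 ‖N k P₀.1 P₀.2‖, lt_min one_pos hpos, fun P hP hsep => ?_⟩
    by_cases hle : ‖N k P.1 P.2‖ ≤ 1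
    · exact (min_le_right _ _).trans (hmin (show P ∈ T from ⟨⟨hP, hle⟩, hsep⟩))
    · exact (min_le_left _ _).trans (not_le.mp hle).le
  · refine ⟨1, one_pos, fun P hP hsep => ?_⟩
    by_contra hlt
    exact hne ⟨P, ⟨hP, (not_le.mp hlt).le⟩, hsep⟩

/-- Monotone variant: separation from any set `Z` CONTAINING the zeros of `N` on `D_e(ℂ)` (e.g. the
fibre `E_φ ⊇ R_t` of the properness package) suffices, with the same constant.
[cite: MochizukiGenEll2010, Thm 2.1 p.12] -/
theorem exists_pos_le_norm_N_of_separated_of_subset (k : ℕ) {ρ : ℝ} (hρ : 0 < ρ) :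
    ∃ c : ℝ, 0 < c ∧ ∀ Z : Set (ℂ × ℂ), {Q | Q ∈ curve ℂ k ∧ N k Q.1 Q.2 = 0} ⊆ Z →
      ∀ P ∈ curve ℂ k, (∀ Q ∈ Z, ρ ≤ dist P Q) → c ≤ ‖N k P.1 P.2‖ := by
  obtain ⟨c, hc, h⟩ := exists_pos_le_norm_N_of_separated k hρ
  exact ⟨c, hc, fun Z hZ P hP hsep => h P hP fun Q hQ hQ0 => hsep Q (hZ ⟨hQ, hQ0⟩)⟩

/-- Log form at one conjugate: under `ρ`-separation, `log⁺ ‖N(P)‖⁻¹ ≤ log⁺ c⁻¹`.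
[cite: MochizukiGenEll2010, Thm 2.1 p.12] -/
theorem posLog_inv_norm_le {c : ℝ} (hc : 0 < c) {z : ℂ} (hz : c ≤ ‖z‖) :
    log⁺ ‖z‖⁻¹ ≤ log⁺ c⁻¹ :=
  posLog_le_posLog (inv_nonneg.mpr (norm_nonneg _)) (by
    have hz0 : 0 < ‖z‖ := hc.trans_le hz
    exact (inv_le_inv₀ hz0 hc).mpr hz)

end Complex

/-! ### Number-field form: the sum over the complex embeddings -/

section NumberField

variable {k : ℕ}

/-- A point of `D_e(K)` gives, under every ring homomorphism `σ : K →+* ℂ`, a point of `D_e(ℂ)`.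
[cite: MochizukiGenEll2010, Thm 2.1 p.12] -/
theorem embedding_mem_curve {K : Type*} [Field K] {x r : K} (hxr : r ^ (2 * k + 1) = x * (1 - x))
    (σ : K →+* ℂ) : ((σ x, σ r) : ℂ × ℂ) ∈ curve ℂ k := by
  rw [mem_curve_iff]
  have h := congrArg σ hxr
  rw [map_pow, map_mul, map_sub, map_one] at h
  exact h

/-- Per-conjugate form, stated with the constant of `exists_pos_le_norm_N_of_separated`: for a field
`K`, `(x, r) ∈ D_e(K)` and a homomorphism `σ : K →+* ℂ` whose conjugate is `ρ`-separated from the zeros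
of `N` on `D_e(ℂ)`, `c ≤ ‖σ(N(x, r))‖`. [cite: MochizukiGenEll2010, Thm 2.1 p.12] -/
theorem le_norm_embedding_N {K : Type*} [Field K] {x r : K} (hxr : r ^ (2 * k + 1) = x * (1 - x))
    {ρ c : ℝ} (h : ∀ P ∈ curve ℂ k, (∀ Q ∈ curve ℂ k, N k Q.1 Q.2 = 0 → ρ ≤ dist P Q) →
      c ≤ ‖N k P.1 P.2‖)
    (σ : K →+* ℂ) (hsep : ∀ Q ∈ curve ℂ k, N k Q.1 Q.2 = 0 → ρ ≤ dist ((σ x, σ r) : ℂ × ℂ) Q) :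
    c ≤ ‖σ (N k x r)‖ := by
  rw [map_N]
  exact h (σ x, σ r) (embedding_mem_curve hxr σ) hsep

/-- SUM OVER THE COMPLEX EMBEDDINGS (the archimedean term of the height of `N(x, r)`), with the constant
of `exists_pos_le_norm_N_of_separated`: for a number field `K` and `(x, r) ∈ D_e(K)` all of whose
conjugates `(σ x, σ r)` are `ρ`-separated from the zeros of `N` on `D_e(ℂ)`,
`Σ_{σ : K →+* ℂ} log⁺ ‖σ(N(x,r))‖⁻¹ ≤ [K:ℚ] · log⁺ c⁻¹`. [cite: MochizukiGenEll2010, Thm 2.1 p.12] -/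
theorem sum_posLog_le {K : Type*} [Field K] [NumberField K] {x r : K}
    (hxr : r ^ (2 * k + 1) = x * (1 - x)) {ρ c : ℝ} (hc : 0 < c)
    (h : ∀ P ∈ curve ℂ k, (∀ Q ∈ curve ℂ k, N k Q.1 Q.2 = 0 → ρ ≤ dist P Q) →
      c ≤ ‖N k P.1 P.2‖)
    (hsep : ∀ σ : K →+* ℂ, ∀ Q ∈ curve ℂ k, N k Q.1 Q.2 = 0 → ρ ≤ dist ((σ x, σ r) : ℂ × ℂ) Q) :
    ∑ σ : K →+* ℂ, log⁺ ‖σ (N k x r)‖⁻¹ ≤ Module.finrank ℚ K * log⁺ c⁻¹ := by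
  have hterm : ∀ σ : K →+* ℂ, log⁺ ‖σ (N k x r)‖⁻¹ ≤ log⁺ c⁻¹ := fun σ =>
    posLog_inv_norm_le hc (le_norm_embedding_N hxr h σ (hsep σ))
  calc ∑ σ : K →+* ℂ, log⁺ ‖σ (N k x r)‖⁻¹
      ≤ ∑ _σ : K →+* ℂ, log⁺ c⁻¹ := Finset.sum_le_sum fun σ _ => hterm σ
    _ = Module.finrank ℚ K * log⁺ c⁻¹ := by
      rw [Finset.sum_const, Finset.card_univ, NumberField.Embeddings.card K ℂ, nsmul_eq_mul]

/-- NUMBER-FIELD FORM, packaged: for every `ρ > 0` there is `C ≥ 0` (depending only on `e` and `ρ`) such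
that for every number field `K` and every `(x, r) ∈ D_e(K)` all of whose complex conjugates are
`ρ`-separated from the zeros of `N` on `D_e(ℂ)`, `Σ_{σ : K →+* ℂ} log⁺ ‖σ(N(x,r))‖⁻¹ ≤ [K:ℚ]·C`.
[cite: MochizukiGenEll2010, Thm 2.1 p.12] -/
theorem exists_sum_posLog_le (k : ℕ) {ρ : ℝ} (hρ : 0 < ρ) :
    ∃ C : ℝ, 0 ≤ C ∧ ∀ (K : Type) [Field K] [NumberField K] (x r : K),
      r ^ (2 * k + 1) = x * (1 - x) →
      (∀ σ : K →+* ℂ, ∀ Q ∈ curve ℂ k, N k Q.1 Q.2 = 0 → ρ ≤ dist ((σ x, σ r) : ℂ × ℂ) Q) →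
      ∑ σ : K →+* ℂ, log⁺ ‖σ (N k x r)‖⁻¹ ≤ Module.finrank ℚ K * C := by
  obtain ⟨c, hc, h⟩ := exists_pos_le_norm_N_of_separated k hρ
  exact ⟨log⁺ c⁻¹, posLog_nonneg, fun K _ _ x r hxr hsep => sum_posLog_le hxr hc h hsep⟩

/-- `InfinitePlace` form of the per-conjugate bound: `c ≤ w (N(x, r))` for every infinite place `w` whose
embedding is `ρ`-separated (`w a = ‖w.embedding a‖`). [cite: MochizukiGenEll2010, Thm 2.1 p.12] -/
theorem le_infinitePlace_N {K : Type*} [Field K] {x r : K} (hxr : r ^ (2 * k + 1) = x * (1 - x))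
    {ρ c : ℝ} (h : ∀ P ∈ curve ℂ k, (∀ Q ∈ curve ℂ k, N k Q.1 Q.2 = 0 → ρ ≤ dist P Q) →
      c ≤ ‖N k P.1 P.2‖)
    (w : NumberField.InfinitePlace K)
    (hsep : ∀ Q ∈ curve ℂ k, N k Q.1 Q.2 = 0 →
      ρ ≤ dist ((w.embedding x, w.embedding r) : ℂ × ℂ) Q) :
    c ≤ w (N k x r) := by
  rw [← NumberField.InfinitePlace.norm_embedding_eq w (N k x r)]
  exact le_norm_embedding_N hxr h w.embedding hsep

/-- `InfinitePlace` log form: `log⁺ (w (N(x,r)))⁻¹ ≤ log⁺ c⁻¹` under `ρ`-separation of `w.embedding`.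
[cite: MochizukiGenEll2010, Thm 2.1 p.12] -/
theorem posLog_infinitePlace_le {K : Type*} [Field K] {x r : K} (hxr : r ^ (2 * k + 1) = x * (1 - x))
    {ρ c : ℝ} (hc : 0 < c)
    (h : ∀ P ∈ curve ℂ k, (∀ Q ∈ curve ℂ k, N k Q.1 Q.2 = 0 → ρ ≤ dist P Q) →
      c ≤ ‖N k P.1 P.2‖)
    (w : NumberField.InfinitePlace K)
    (hsep : ∀ Q ∈ curve ℂ k, N k Q.1 Q.2 = 0 →
      ρ ≤ dist ((w.embedding x, w.embedding r) : ℂ × ℂ) Q) :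
    log⁺ (w (N k x r))⁻¹ ≤ log⁺ c⁻¹ := by
  rw [← NumberField.InfinitePlace.norm_embedding_eq w (N k x r)]
  exact posLog_inv_norm_le hc (le_norm_embedding_N hxr h w.embedding hsep)

end NumberField

end DeArch

end Literature.NumberTheory.DiophantineGeometry.GenEll
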